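import Literature.MathematicalPhysics.QuantumFieldTheory.Balaban1983to89.Beta.Transfer
import Literature.MathematicalPhysics.QuantumFieldTheory.Balaban1983to89.Beta.AssemblyRemainder
import Literature.MathematicalPhysics.QuantumFieldTheory.Balaban1983to89.Beta.BetaContinuity

/-!
# `Balaban1983to89.Beta.TransferEventual` — BETA sub-cell (unit b2b-balaban-pv14, answering REFEREE-BETA.md R31):
the minimal carrier `EventualForm` of row an5 (`Beta.Assembly`) FROM THE QUALITATIVE TRANSFER STATEMENT, with NO RATE

HONEST FRAMING (cell file `HOME/BETA-SPEC.md`, verbatim): discharging `BetaPertH` makes Bałaban's UV stability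
UNCONDITIONAL — a real constructive-QFT result; it is NOT the continuum limit and NOT the Clay problem.  THIS MODULE
DISCHARGES NOTHING: hypothesis shapes and implications only; nothing is asserted about Bałaban's actual (1.22), and no
`def … : Prop` is introduced.  Value = bookkeeping implication, NOT summit progress.

What is composed (everything BY NAME; no existing module is modified).
* `Beta.Transfer.eventually_ge_half_of_transferBal` (row an3): `B12Normalization.TransferBal b N L` — the one-loop
  coefficients `b k = β⁰_{k+1}` TEND to `stepBal N L = (11N²/12π²) log L` (Bałaban's units), a HYPOTHESIS SHAPE
  asserted of nothing — with `0 < N`, `1 < L` gives a scale `k₀` from which `stepBal N L / 2 ≤ β⁰_{k+1}`.  Without a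
  rate `k₀` is NOT explicit; here it is chosen classically (`transferScale`).
* `Beta.Assembly.EventualForm.ofSplitOneSided` (row an5, v1.1) / `Beta.AssemblyRemainder.eventualForm_of_remainderConst`
  and `eventualForm_of_chain` (row an4): an eventual one-loop bound `2b ≤ β⁰_{k+1}`, a remainder bound on the
  ]0,γ₀]-boxes (one-sided constant `−r ≤ β¹_{k+1}`, or two-sided `RemainderConst`, or the printed remainder CHAIN under
  the ε₁-restriction), the printed two-sided bound (TS) and joint continuity (C) give `EventualForm β`.
* `Beta.BetaContinuity.betaContH_of_chain` (row an4): on the chain road (C) reduces to termwise continuity of the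
  represented kernels.

Result (the referee's R31 «`EventualForm.ofTransfer`», here `eventualForm_of_transferBal`): on the transfer road the
β-input of the END statement is `TransferBal` + a remainder bound with `r ≤ stepBal N L / 4` + (TS) + (C) — NO rate
(AF-0r), NO `LimitRate.KernelInputs`, NO (AF-1) Lipschitz constant; consumers by dot-notation on the carrier
(`EventualForm.endpointExistence`, `.p355_and_sum246`, `.thm2_fineLattices`, `.thm2Printed_of_list`), the corollaries
below spelling out endpoint existence and Theorem 2 (the finite β-level list, measured against `stepBal N L / 4`, of
NON-explicit length `transferScale`).  `Beta.Assembly.LimitForm.ofTransfer` remains the road WITH a rate (through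
`KernelInputs`), needed only to make `k₀` a number.  The (AF-1)-linear-form variant feeding (PS) directly
(`betaPartialSumsLowerH_of_transferBal`, pv14 scratch `HOME/b2b-balaban-pv14/TransferPS.lean`) is row an3's to fold
into `Beta.Transfer` and is not repeated here.  Cell audit ids: GAPS G-pv14-3 / REFEREE-BETA R31 (the wording this
answers), C-pv14-22 (kernel certificate of this file).
-/

namespace Literature.MathematicalPhysics.QuantumFieldTheory.Balaban1983to89.Beta.TransferEventual

open Filter Topology
open Literature.MathematicalPhysics.QuantumFieldTheory.Balaban1983to89
open Literature.MathematicalPhysics.QuantumFieldTheory.Balaban1983to89.FlowStep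
open Literature.MathematicalPhysics.QuantumFieldTheory.Balaban1983to89.DagBinding
open Literature.MathematicalPhysics.QuantumFieldTheory.Balaban1983to89.FlowStepRuns
open Literature.MathematicalPhysics.QuantumFieldTheory.Balaban1983to89.B12Normalization
open Literature.MathematicalPhysics.QuantumFieldTheory.Balaban1983to89.Beta.Assembly
open Literature.MathematicalPhysics.QuantumFieldTheory.Balaban1983to89.Beta.RemainderChain
open Literature.MathematicalPhysics.QuantumFieldTheory.Balaban1983to89.Beta.AssemblyRemainder
open Literature.MathematicalPhysics.QuantumFieldTheory.Balaban1983to89.Beta.BetaContinuity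
open Literature.MathematicalPhysics.QuantumFieldTheory.Balaban1983to89.Beta.Transfer

noncomputable section

/-! ## 1. From a bare eventual one-loop sign (the referee's `ofEventualBeta0`, ∃-form) -/

/-- **`EventualForm` from an EVENTUAL one-loop bound in ∃-form**: `∃ k₀, ∀ k ≥ k₀, 2b ≤ β⁰_{k+1}`, a one-sided constant
remainder bound `−r ≤ β¹_{k+1}` on the ]0,γ₀]-boxes with `r ≤ b`, (TS) and (C) give the minimal carrier with eventual
lower bound `b` (`Beta.Assembly.EventualForm.ofSplitOneSided`, the scale unpacked).  [cite: Balaban1987RG1, §1 p.264] -/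
theorem exists_eventualForm_of_eventualBeta0 {β : HBeta} (S : B12Beta.OneLoopSplit β) {γ₀ b r β' : ℝ}
    (hγ₀ : 0 < γ₀) (hb : 0 < b) (hAF0 : ∃ k₀ : ℕ, ∀ k, k₀ ≤ k → 2 * b ≤ S.β0 k)
    (hrem : ∀ k, ∀ v ∈ Box γ₀ k, -r ≤ S.β1 k v) (hr : r ≤ b) (hup : BetaUpperH β' γ₀ β)
    (hlo : ∀ k, ∀ v ∈ Box γ₀ k, -β' ≤ β k v) (hcont : BetaContH γ₀ β) :
    ∃ E : EventualForm β, E.γ₀ = γ₀ ∧ E.b = b ∧ E.β' = β' := by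
  obtain ⟨k₀, hk₀⟩ := hAF0
  exact ⟨EventualForm.ofSplitOneSided S hγ₀ hb hk₀ (fun k _ v hv => by have h := hrem k v hv; linarith)
    hup hlo hcont, rfl, rfl, rfl⟩

/-! ## 2. From the transfer statement: the scale, the carrier, the consumers -/

/-- The scale from which `stepBal N L / 2 ≤ β⁰_{k+1}` — chosen classically from
`Beta.Transfer.eventually_ge_half_of_transferBal`; NOT explicit without a rate. [folklore] -/
def transferScale {b : ℕ → ℝ} {N L : ℝ} (hT : TransferBal b N L) (hN : 0 < N) (hL : 1 < L) : ℕ :=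
  Classical.choose (eventually_ge_half_of_transferBal hT (stepBal_pos hN hL))

/-- Its defining property. [folklore] -/
theorem transferScale_spec {b : ℕ → ℝ} {N L : ℝ} (hT : TransferBal b N L) (hN : 0 < N) (hL : 1 < L) :
    ∀ k, transferScale hT hN hL ≤ k → stepBal N L / 2 ≤ b k :=
  Classical.choose_spec (eventually_ge_half_of_transferBal hT (stepBal_pos hN hL))

/-- **`EventualForm` FROM THE TRANSFER STATEMENT** (REFEREE-BETA R31's `EventualForm.ofTransfer`): `TransferBal S.β0 N L`
with `0 < N`, `1 < L`, a one-sided constant remainder bound `−r ≤ β¹_{k+1}` on the ]0,γ₀]-boxes with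
`r ≤ stepBal N L / 4`, (TS) and (C) give the minimal carrier with `b = stepBal N L / 4` and `k₀ = transferScale`.
NO rate, NO `KernelInputs`, NO Lipschitz constant. [cite: Balaban1987RG1, (1.22) p.264 and Thm 2 p.259] -/
def eventualForm_of_transferBal {β : HBeta} (S : B12Beta.OneLoopSplit β) {N L γ₀ r β' : ℝ}
    (hT : TransferBal S.β0 N L) (hN : 0 < N) (hL : 1 < L) (hγ₀ : 0 < γ₀)
    (hrem : ∀ k, ∀ v ∈ Box γ₀ k, -r ≤ S.β1 k v) (hr : r ≤ stepBal N L / 4) (hup : BetaUpperH β' γ₀ β)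
    (hlo : ∀ k, ∀ v ∈ Box γ₀ k, -β' ≤ β k v) (hcont : BetaContH γ₀ β) : EventualForm β :=
  EventualForm.ofSplitOneSided S hγ₀ (b := stepBal N L / 4) (k₀ := transferScale hT hN hL)
    (by have h := stepBal_pos hN hL; linarith)
    (fun k hk => by have h := transferScale_spec hT hN hL k hk; linarith)
    (fun k _ v hv => by have h := hrem k v hv; linarith) hup hlo hcont

/-- The carrier's constants: box `γ₀`, eventual bound `stepBal N L / 4`, scale `transferScale`, upper constant `β′`.
[folklore] -/
theorem eventualForm_of_transferBal_consts {β : HBeta} (S : B12Beta.OneLoopSplit β) {N L γ₀ r β' : ℝ}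
    (hT : TransferBal S.β0 N L) (hN : 0 < N) (hL : 1 < L) (hγ₀ : 0 < γ₀)
    (hrem : ∀ k, ∀ v ∈ Box γ₀ k, -r ≤ S.β1 k v) (hr : r ≤ stepBal N L / 4) (hup : BetaUpperH β' γ₀ β)
    (hlo : ∀ k, ∀ v ∈ Box γ₀ k, -β' ≤ β k v) (hcont : BetaContH γ₀ β) :
    (eventualForm_of_transferBal S hT hN hL hγ₀ hrem hr hup hlo hcont).γ₀ = γ₀ ∧
      (eventualForm_of_transferBal S hT hN hL hγ₀ hrem hr hup hlo hcont).b = stepBal N L / 4 ∧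
      (eventualForm_of_transferBal S hT hN hL hγ₀ hrem hr hup hlo hcont).k₀ = transferScale hT hN hL ∧
      (eventualForm_of_transferBal S hT hN hL hγ₀ hrem hr hup hlo hcont).β' = β' :=
  ⟨rfl, rfl, rfl, rfl⟩

/-- **Endpoint existence on the transfer road** (forward-generated constructions): no rate, no small-k signs.
[cite: Balaban1987RG1, Thm 2 p.259 (first sentence)] -/
theorem endpointExistence_of_transferBal {β : HBeta} (S : B12Beta.OneLoopSplit β) {N L γ₀ r β' : ℝ}
    (hT : TransferBal S.β0 N L) (hN : 0 < N) (hL : 1 < L) (hγ₀ : 0 < γ₀)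
    (hrem : ∀ k, ∀ v ∈ Box γ₀ k, -r ≤ S.β1 k v) (hr : r ≤ stepBal N L / 4) (hup : BetaUpperH β' γ₀ β)
    (hlo : ∀ k, ∀ v ∈ Box γ₀ k, -β' ≤ β k v) (hcont : BetaContH γ₀ β)
    {C : B12.Construction} (hgen : ForwardGenerated C β) : EndpointExistence C :=
  (eventualForm_of_transferBal S hT hN hL hγ₀ hrem hr hup hlo hcont).endpointExistence hgen

/-- **The lower half of (0.31) on FINE lattices on the transfer road** — no small-k sign; the threshold scale is the
non-explicit `transferScale` (`EventualForm.thm2_fineLattices` of row an5 with `b = stepBal N L / 4`).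
[cite: Balaban1987RG1, Thm 2 (0.31) p.259] -/
theorem thm2_fineLattices_of_transferBal {β : HBeta} (S : B12Beta.OneLoopSplit β) {N L γ₀ r β' : ℝ}
    (hT : TransferBal S.β0 N L) (hN : 0 < N) (hL : 1 < L) (hγ₀ : 0 < γ₀)
    (hrem : ∀ k, ∀ v ∈ Box γ₀ k, -r ≤ S.β1 k v) (hr : r ≤ stepBal N L / 4) (hup : BetaUpperH β' γ₀ β)
    (hlo : ∀ k, ∀ v ∈ Box γ₀ k, -β' ≤ β k v) (hcont : BetaContH γ₀ β)
    {C : B12.Construction} (hgen : ForwardGenerated C β) :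
    ∀ (m : ℕ) (γ : ℝ), 0 < γ → γ ≤ γ₀ → ∀ g : ℝ, 0 < g → 1 / γ ^ 2 + β' * transferScale hT hN hL ≤ 1 / g ^ 2 →
      ∀ K : ℕ, (3 * (stepBal N L / 4) + 2 * β') * transferScale hT hN hL ≤ stepBal N L / 4 * K →
        ∃ g0 : ℝ, (C ⟨K, m, g0⟩).flow.InInterval γ K ∧ (C ⟨K, m, g0⟩).flow.g K = g ∧
          Step.Discrete031 (stepBal N L / 4 / 2) β' K g (C ⟨K, m, g0⟩).flow.g :=
  (eventualForm_of_transferBal S hT hN hL hγ₀ hrem hr hup hlo hcont).thm2_fineLattices hgen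

/-- **Theorem 2 AS PRINTED on the transfer road, from the finite β-level list** `stepBal N L₀ / 4 ≤ β_{k+1}` on
]0,γ₀]^{k+1} for `k < transferScale` (the one place the small-k signs are consumed; the list's length is NOT explicit
without a rate — `Beta.Assembly.thm2Printed_of_wall_transfer` is the rate version).
[cite: Balaban1987RG1, Thm 2 p.259 with (0.31)] -/
theorem thm2Printed_of_transferBal_list {β : HBeta} (S : B12Beta.OneLoopSplit β) {N L₀ γ₀ r β' : ℝ}
    (hT : TransferBal S.β0 N L₀) (hN : 0 < N) (hL₀ : 1 < L₀) (hγ₀ : 0 < γ₀)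
    (hrem : ∀ k, ∀ v ∈ Box γ₀ k, -r ≤ S.β1 k v) (hr : r ≤ stepBal N L₀ / 4) (hup : BetaUpperH β' γ₀ β)
    (hlo : ∀ k, ∀ v ∈ Box γ₀ k, -β' ≤ β k v) (hcont : BetaContH γ₀ β)
    {C : B12.Construction} (hgen : ForwardGenerated C β) {L : ℝ} (hL : 1 < L)
    (hsmall : ∀ k, k < transferScale hT hN hL₀ → ∀ v ∈ Box γ₀ k, stepBal N L₀ / 4 ≤ β k v) :
    B12.Thm2Printed C L :=
  (eventualForm_of_transferBal S hT hN hL₀ hγ₀ hrem hr hup hlo hcont).thm2Printed_of_list hgen hL hsmall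

/-- The same with the scale existentially packaged (for statements that should not mention `transferScale`).
[cite: Balaban1987RG1, Thm 2 p.259 with (0.31)] -/
theorem exists_scale_thm2Printed_of_transferBal {β : HBeta} (S : B12Beta.OneLoopSplit β) {N L₀ γ₀ r β' : ℝ}
    (hT : TransferBal S.β0 N L₀) (hN : 0 < N) (hL₀ : 1 < L₀) (hγ₀ : 0 < γ₀)
    (hrem : ∀ k, ∀ v ∈ Box γ₀ k, -r ≤ S.β1 k v) (hr : r ≤ stepBal N L₀ / 4) (hup : BetaUpperH β' γ₀ β)
    (hlo : ∀ k, ∀ v ∈ Box γ₀ k, -β' ≤ β k v) (hcont : BetaContH γ₀ β)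
    {C : B12.Construction} (hgen : ForwardGenerated C β) {L : ℝ} (hL : 1 < L) :
    ∃ k₀ : ℕ, (∀ k, k < k₀ → ∀ v ∈ Box γ₀ k, stepBal N L₀ / 4 ≤ β k v) → B12.Thm2Printed C L :=
  ⟨transferScale hT hN hL₀, thm2Printed_of_transferBal_list S hT hN hL₀ hγ₀ hrem hr hup hlo hcont hgen hL⟩

/-! ## 3. The remainder slot in row an4's forms: two-sided constant bound, and the printed chain -/

/-- **Transfer statement + two-sided constant remainder bound** `|β¹_{k+1}| ≤ r ≤ stepBal N L / 4` on ]0,γ₀]-histories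
(`Beta.RemainderChain.RemainderConst`; `Beta.AssemblyRemainder.eventualForm_of_remainderConst`).
[cite: Balaban1987RG1, (1.22) p.264 and Thm 2 p.259] -/
def eventualForm_of_transferBal_remainderConst {β : HBeta} (S : B12Beta.OneLoopSplit β) {N L γ₀ r β' : ℝ}
    (hT : TransferBal S.β0 N L) (hN : 0 < N) (hL : 1 < L) (hγ₀ : 0 < γ₀) (hrem : RemainderConst S γ₀ r)
    (hr : r ≤ stepBal N L / 4) (hup : BetaUpperH β' γ₀ β) (hlo : ∀ k, ∀ v ∈ Box γ₀ k, -β' ≤ β k v)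
    (hcont : BetaContH γ₀ β) : EventualForm β :=
  eventualForm_of_remainderConst S hγ₀ (b := stepBal N L / 4) (k₀ := transferScale hT hN hL)
    (by have h := stepBal_pos hN hL; linarith)
    (fun k hk => by have h := transferScale_spec hT hN hL k hk; linarith) hrem hr hup hlo hcont

/-- Its constants. [folklore] -/
theorem eventualForm_of_transferBal_remainderConst_consts {β : HBeta} (S : B12Beta.OneLoopSplit β)
    {N L γ₀ r β' : ℝ} (hT : TransferBal S.β0 N L) (hN : 0 < N) (hL : 1 < L) (hγ₀ : 0 < γ₀)
    (hrem : RemainderConst S γ₀ r) (hr : r ≤ stepBal N L / 4) (hup : BetaUpperH β' γ₀ β)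
    (hlo : ∀ k, ∀ v ∈ Box γ₀ k, -β' ≤ β k v) (hcont : BetaContH γ₀ β) :
    (eventualForm_of_transferBal_remainderConst S hT hN hL hγ₀ hrem hr hup hlo hcont).b = stepBal N L / 4 ∧
      (eventualForm_of_transferBal_remainderConst S hT hN hL hγ₀ hrem hr hup hlo hcont).γ₀ = γ₀ ∧
      (eventualForm_of_transferBal_remainderConst S hT hN hL hγ₀ hrem hr hup hlo hcont).k₀ =
        transferScale hT hN hL :=
  eventualForm_of_remainderConst_b S hγ₀ _ _ hrem hr hup hlo hcont

/-- **Transfer statement + the printed remainder CHAIN** (row an4's `Chain`: the leaves of [II] §2 and (5.10) as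
hypotheses, by name) under the ε₁-restriction `ε₁·K_rem ≤ stepBal N L / 4`, (TS) and (C).
[cite: Balaban1988RG2Cluster, (2.41) p.21; Balaban1987RG1, (5.10) p.293 and (1.22) p.264] -/
def eventualForm_of_transferBal_chain {d : ℕ} {μ ν : Fin d} {β : HBeta} (S : B12Beta.OneLoopSplit β)
    {N L γ₀ β' : ℝ} {c : B13.Consts} {α₂ B₃ c₁ K₀ K₁ : ℝ} (hT : TransferBal S.β0 N L) (hN : 0 < N) (hL : 1 < L)
    (R : Chain d μ ν S γ₀ c α₂ B₃ c₁ K₀ K₁) (hs : ChainSigns c α₂ B₃ K₀) (hγ₀ : 0 < γ₀)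
    (hε₁ : c.ε₁ * remCoeff d c α₂ B₃ c₁ K₀ K₁ ≤ stepBal N L / 4) (hup : BetaUpperH β' γ₀ β)
    (hlo : ∀ k, ∀ v ∈ Box γ₀ k, -β' ≤ β k v) (hcont : BetaContH γ₀ β) : EventualForm β :=
  eventualForm_of_chain S R hs hγ₀ (b := stepBal N L / 4) (k₀ := transferScale hT hN hL)
    (by have h := stepBal_pos hN hL; linarith)
    (fun k hk => by have h := transferScale_spec hT hN hL k hk; linarith) hε₁ hup hlo hcont

/-- **THE END-STATEMENT WALL ON THE TRANSFER ROAD ⇒ endpoint existence**: `TransferBal` (row an3) + the printed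
remainder chain with its signs and the ε₁-restriction (row an4, leaves as hypotheses) + (TS) (printed) + termwise
continuity of the represented kernels (row an4's reduction of (C), `Beta.BetaContinuity.betaContH_of_chain`) + forward
generation (modelling).  No rate, no `KernelInputs`, no (AF-1), no small-k signs.
[cite: Balaban1987RG1, Thm 2 p.259 (first sentence)] -/
theorem endpointExistence_of_transferBal_chain {d : ℕ} {μ ν : Fin d} {β : HBeta} (S : B12Beta.OneLoopSplit β)
    {N L γ₀ β' : ℝ} {c : B13.Consts} {α₂ B₃ c₁ K₀ K₁ : ℝ} (hT : TransferBal S.β0 N L) (hN : 0 < N) (hL : 1 < L)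
    (R : Chain d μ ν S γ₀ c α₂ B₃ c₁ K₀ K₁) (hs : ChainSigns c α₂ B₃ K₀) (hγ₀ : 0 < γ₀)
    (hε₁ : c.ε₁ * remCoeff d c α₂ B₃ c₁ K₀ K₁ ≤ stepBal N L / 4) (hup : BetaUpperH β' γ₀ β)
    (hlo : ∀ k, ∀ v ∈ Box γ₀ k, -β' ≤ β k v)
    (hcontP : ∀ k (x : Fin d → ℤ), ContinuousOn (fun v => R.P1 k v μ ν x) (Box γ₀ k))
    {C : B12.Construction} (hgen : ForwardGenerated C β) : EndpointExistence C :=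
  (eventualForm_of_transferBal_chain S hT hN hL R hs hγ₀ hε₁ hup hlo (betaContH_of_chain R hs hcontP)).endpointExistence
    hgen

/-- **… ⇒ Theorem 2 AS PRINTED**, given the finite β-level list below the (non-explicit) scale.
[cite: Balaban1987RG1, Thm 2 p.259 with (0.31)] -/
theorem thm2Printed_of_transferBal_chain_list {d : ℕ} {μ ν : Fin d} {β : HBeta} (S : B12Beta.OneLoopSplit β)
    {N L₀ γ₀ β' : ℝ} {c : B13.Consts} {α₂ B₃ c₁ K₀ K₁ : ℝ} (hT : TransferBal S.β0 N L₀) (hN : 0 < N)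
    (hL₀ : 1 < L₀) (R : Chain d μ ν S γ₀ c α₂ B₃ c₁ K₀ K₁) (hs : ChainSigns c α₂ B₃ K₀) (hγ₀ : 0 < γ₀)
    (hε₁ : c.ε₁ * remCoeff d c α₂ B₃ c₁ K₀ K₁ ≤ stepBal N L₀ / 4) (hup : BetaUpperH β' γ₀ β)
    (hlo : ∀ k, ∀ v ∈ Box γ₀ k, -β' ≤ β k v)
    (hcontP : ∀ k (x : Fin d → ℤ), ContinuousOn (fun v => R.P1 k v μ ν x) (Box γ₀ k))
    {C : B12.Construction} (hgen : ForwardGenerated C β) {L : ℝ} (hL : 1 < L)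
    (hsmall : ∀ k, k < transferScale hT hN hL₀ → ∀ v ∈ Box γ₀ k, stepBal N L₀ / 4 ≤ β k v) :
    B12.Thm2Printed C L :=
  (eventualForm_of_transferBal_chain S hT hN hL₀ R hs hγ₀ hε₁ hup hlo
    (betaContH_of_chain R hs hcontP)).thm2Printed_of_list hgen hL hsmall

/-! ## 4. Non-vacuity: the hypotheses of `eventualForm_of_transferBal` are jointly satisfiable -/

namespace Witness

/-- The constant family `β_{k+1} ≡ stepBal 1 2`. [folklore] -/
def constBal : HBeta := fun _ _ => stepBal 1 2

/-- Its trivial split: `β⁰ ≡ stepBal 1 2`, `β¹ ≡ 0`. [folklore] -/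
def splitBal : B12Beta.OneLoopSplit constBal where
  β0 := fun _ => stepBal 1 2
  β1 := fun _ _ => 0
  split := fun _ _ => by simp [constBal]
  vanish := fun _ _ _ => rfl

/-- The constant family satisfies the transfer statement for `N = 1`, `L = 2`. [folklore] -/
theorem transferBal_splitBal : TransferBal splitBal.β0 1 2 := by
  show Tendsto (fun _ : ℕ => stepBal 1 2) atTop (𝓝 (stepBal 1 2))
  exact tendsto_const_nhds

/-- Non-vacuity: all hypotheses of `eventualForm_of_transferBal` hold for the constant family (`γ₀ = 1`, `r = 0`,
`β′ = stepBal 1 2`). [folklore] -/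
theorem eventualForm_of_transferBal_nonvacuous :
    ∃ E : EventualForm constBal, E.b = stepBal 1 2 / 4 := by
  have hpos : 0 < stepBal 1 2 := stepBal_pos one_pos one_lt_two
  exact ⟨eventualForm_of_transferBal splitBal (γ₀ := 1) (r := 0) (β' := stepBal 1 2) transferBal_splitBal one_pos
    one_lt_two one_pos (fun k v _ => by simp [splitBal]) (by linarith) (fun k v _ => le_rfl)
    (fun k v _ => by show -stepBal 1 2 ≤ stepBal 1 2; linarith) (fun k => continuousOn_const), rfl⟩

end Witness

end

end Literature.MathematicalPhysics.QuantumFieldTheory.Balaban1983to89.Beta.TransferEventual
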